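import Mathlib
import HarnessLib
import Summits.Ventures.LatticeQCDFlow.Scoring.DoeblinPowerBatchMeansDeltaMethod
import Summits.Ventures.LatticeQCDFlow.Scoring.RestartJarzynskiWeights
import Summits.Ventures.LatticeQCDFlow.Scoring.RestartTimeAverage

/-!
# THE ERROR BAR OF THE CORRELATED-RESTART JARZYNSKI ESTIMATOR (S0-D2's NE-MCMC protocol):
# `√N (ΔF̂_N − ΔF) / (σ̂_N / Ḡ_N) ⇒ N(0, 1)` from any start, `ΔF̂_N = −log Ḡ_N`, `Ḡ_N` the average
# Jarzynski weight along the restart chain, `σ̂²_N` its batch-means estimator — and exact coverage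

HONEST FRAMING: exact (Metropolis-corrected) sampling algorithms for lattice gauge theory;
figures of merit are autocorrelation/cost numbers at stated couplings and volumes; no
continuum-physics claim.

Venture `LatticeQCDFlow` (cell pub-lqcd), topic `Scoring`; FANOUT row 8 (`s0-cpn-nemc` — S0-D2 is
THIS protocol: Bonanno–Nada–Vadacchino 2024 start each non-equilibrium evolution from the current
state of an equilibrium PRIOR chain and average the Jarzynski weights `e^{−W}`; NAMED ONLY — GEN-22).
NEW WORK of the cell, not a published result; no definition is introduced; nothing is cited as a
fact.  Objects of rows 8 / 13: a Crooks pair `(κF, κR, s, e, W)` from `ν₀` to `ν₁`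
(`Exactness/NCMCGeneralSpace*.lean`), a prior chain `κ₀` leaving `π₀ = Z₀⁻¹ ν₀` invariant with a
one-step Doeblin constant `κ₀(x,·) ≥ ε π₀`, the RESTART chain
`K = prodMkRight E κ₀ ⊗ₖ prodMkLeft (Ω × E) κF` on `Ω × E` with invariant law `Π = π₀ ⊗ₘ κF`
(`Scoring/RestartChainAutocorrelation.lean`; `restart_doeblin`: the same `ε` minorises `K` by `Π`),
and the Jarzynski weight `G(x, ω) = e^{−W(ω)}`, bounded under a work floor `W ≥ W_lo`, with
`∫ G dΠ = Z₁/Z₀ = e^{−ΔF}` WHATEVER the stride (`Scoring/RestartJarzynskiWeights.restart_jarzynski_mean`).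
GEN-19's `Scoring/BatchMeansInstances.restart_batchMeans_studentized_coverage` gave the batch-means
interval for the MEAN weight `Ḡ_N`, and row 13's
`Exactness/NCMCGeneralSpaceStudentizedCLT.tendstoInDistribution_studentized_jarzynskiEstimate` the
studentised `ΔF̂` for INDEPENDENT records with the Kish-ESS error bar; the printed number of the
correlated-restart protocol is `ΔF̂_N = −log Ḡ_N` along ONE correlated run.  By the studentised
delta method with the batch-means error bar (`Scoring/DoeblinPowerBatchMeansDeltaMethod.lean`,
`φ = −log`, `φ(e^{−ΔF}) = ΔF`, `φ' = −1/q`): for EVERY initial law of the restart chain, any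
`a_n, b_n → ∞` (`N_n = b_n a_n`) and `σ²_G > 0` (ASSUMED):
`√N_n (ΔF̂_{N_n} − ΔF) / (|−Ḡ⁻¹| √(σ̂²_n)) ⇒ N(0, 1)` — the reported interval
`ΔF̂ ± z σ̂_n/(Ḡ √N)` is asymptotically exact, with the prior chain's autocorrelations priced by
`σ̂²_n` (they ARE the prior chain's autocovariances of `h = E[e^{−W} | start]`,
`RestartJarzynskiWeights.restart_jarzynski_autocov_succ`).  Printed counterparts NAMED ONLY: error
analysis of Jarzynski / NE-MCMC free-energy estimators with correlated starting configurations
(Bonanno–Nada–Vadacchino 2024 §3; Caselle et al. 2016), nothing cited as a fact.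

## Content (`Π = π₀ ⊗ₘ κF`, `K` the restart kernel, `Ḡ_N = Σ_{t<N} e^{−W(ω_t)}/N`, `ΔF̂_N = −log Ḡ_N`)

* **`restart_jarzynski_deltaF_studentized_clt`** — for `Y ~ N(0, 1)`:
  `TendstoInDistribution (fun n x => √N_n (ΔF̂ − ΔF) / (|−Ḡ⁻¹| √(σ̂²_n))) atTop Y P_{μ₀}`;
* **`restart_jarzynski_deltaF_coverage`** — `z > 0`:
  `P_{μ₀} {|√N_n (ΔF̂ − ΔF)| / (|−Ḡ⁻¹| √(σ̂²_n)) ≤ z} → (gaussianReal 0 1)[−z, z]`.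

NOT CLAIMED: any value of `σ²_G` or `ε` for a concrete protocol; the degenerate case `σ²_G = 0`;
the bias of `ΔF̂_N` at finite `N` (Jensen; `Scoring/JarzynskiEstimatorBias.lean`); any number of ours.
-/

noncomputable section

namespace Summit.Ventures.LatticeQCDFlow.Scoring

open MeasureTheory ProbabilityTheory Filter Finset Preorder Set
open Summit.Ventures.LatticeQCDFlow.Exactness Summit.Ventures.LatticeQCDFlow.Exactness.GeneralNCMC
open scoped ENNReal Topology

section Restart

variable {Ω E : Type*} [MeasurableSpace Ω] [MeasurableSpace E]
  {ν₀ ν₁ : Measure Ω} [IsFiniteMeasure ν₀] [IsFiniteMeasure ν₁] {κF κR : Kernel Ω E}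
  [IsMarkovKernel κF] [IsMarkovKernel κR] {s e : E → Ω} {W : E → ℝ}
  {κ₀ : Kernel Ω Ω} [IsMarkovKernel κ₀] {π₀ : Measure Ω} [IsProbabilityMeasure π₀] {ε : ℝ≥0∞}

omit [IsFiniteMeasure ν₀] [IsFiniteMeasure ν₁] in
/-- **THE STUDENTISED JARZYNSKI ESTIMATOR ALONG THE RESTART CHAIN IS ASYMPTOTICALLY STANDARD
NORMAL, FROM ANY START.**  Crooks pair, `π₀ = Z₀⁻¹ ν₀` invariant for the prior chain `κ₀` with
`κ₀(x,·) ≥ ε π₀` (`0 < ε`), work floor `W ≥ W_lo`, `e^{−ΔF} = Z₁/Z₀`, `σ²_G > 0`, `a_n, b_n → ∞`,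
`N_n = b_n a_n`; for `Y ~ N(0, 1)`:
`√N_n (−log Ḡ_{N_n} − ΔF) / (|−Ḡ⁻¹| √(σ̂²_n)) ⇒ Y` under `P_{μ₀}`, for every initial law `μ₀`
on `Ω × E`. -/
theorem restart_jarzynski_deltaF_studentized_clt (h : CrooksPair ν₀ ν₁ κF κR s e W)
    (hπ₀ : π₀ = (ν₀ univ)⁻¹ • ν₀) (hinv : Kernel.Invariant κ₀ π₀)
    (hmin : ∀ x {B : Set Ω}, MeasurableSet B → ε * π₀ B ≤ κ₀ x B) (hε0 : 0 < ε)
    {Wlo : ℝ} (hlo : ∀ ω, Wlo ≤ W ω)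
    {ΔF : ℝ} (hΔF : Real.exp (-ΔF) = ((ν₀ univ)⁻¹ * ν₁ univ).toReal)
    (hσ : 0 < ((∫ p, (Real.exp (-W p.2) - ∫ p', Real.exp (-W p'.2) ∂(π₀ ⊗ₘ κF)) ^ 2 ∂(π₀ ⊗ₘ κF))
          + 2 * ∑' k, ∫ p, (Real.exp (-W p.2) - ∫ p', Real.exp (-W p'.2) ∂(π₀ ⊗ₘ κF))
            * (kop ((Kernel.prodMkRight E κ₀) ⊗ₖ (Kernel.prodMkLeft (Ω × E) κF)))^[k + 1]
              (fun p => Real.exp (-W p.2) - ∫ p', Real.exp (-W p'.2) ∂(π₀ ⊗ₘ κF)) p ∂(π₀ ⊗ₘ κF)))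
    (μ₀ : Measure (Ω × E)) [IsProbabilityMeasure μ₀] {a b : ℕ → ℕ} (ha : Tendsto a atTop atTop)
    (hb : Tendsto b atTop atTop)
    {Ω' : Type*} [MeasurableSpace Ω'] {P' : Measure Ω'} [IsProbabilityMeasure P'] {Y : Ω' → ℝ}
    (hY : HasLaw Y (gaussianReal 0 1) P')
    [IsProbabilityMeasure (Kernel.trajMeasure (X := fun _ : ℕ => Ω × E) μ₀
          (fun n : ℕ => ((Kernel.prodMkRight E κ₀) ⊗ₖ (Kernel.prodMkLeft (Ω × E) κF)).comap
            (fun h : (i : ↥(Finset.Iic n)) → Ω × E => h ⟨n, Finset.mem_Iic.2 le_rfl⟩)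
            (measurable_pi_apply _)))] :
    TendstoInDistribution (fun (n : ℕ) (x : ℕ → Ω × E) =>
        Real.sqrt ((b n * a n : ℕ) : ℝ)
          * (-Real.log ((∑ t ∈ Finset.range (b n * a n), Real.exp (-W (x t).2))
            / ((b n * a n : ℕ) : ℝ)) - ΔF)
         
          / (|(-((∑ t ∈ Finset.range (b n * a n), Real.exp (-W (x t).2)) / ((b n * a n : ℕ) : ℝ))⁻¹)|
            * Real.sqrt (((b n * a n : ℕ) : ℝ) * replicaSEsq (fun j (x : ℕ → Ω × E) =>
              (∑ i ∈ Finset.range (b n), Real.exp (-W (x (b n * j + i)).2)) / (b n)) (a n) x)))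
      atTop Y (fun _ => (Kernel.trajMeasure (X := fun _ : ℕ => Ω × E) μ₀
          (fun n : ℕ => ((Kernel.prodMkRight E κ₀) ⊗ₖ (Kernel.prodMkLeft (Ω × E) κF)).comap
            (fun h : (i : ↥(Finset.Iic n)) → Ω × E => h ⟨n, Finset.mem_Iic.2 le_rfl⟩)
            (measurable_pi_apply _)))) P' := by
  -- the restart chain is minorised in ONE step by its invariant law
  have hmin1 : ∀ z, ε • (π₀ ⊗ₘ κF)
      ≤ nHit ((Kernel.prodMkRight E κ₀) ⊗ₖ (Kernel.prodMkLeft (Ω × E) κF)) 1 z := fun z => by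
    rw [nHit_one]
    refine Measure.le_iff.2 fun B hB => ?_
    rw [Measure.smul_apply, smul_eq_mul]
    exact restart_doeblin (κF := κF) hmin z hB
  haveI : Nonempty (Ω × E) := nonempty_of_isProbabilityMeasure μ₀
  have hε1 : ε ≤ 1 := by
    haveI := isMarkovKernel_nHit ((Kernel.prodMkRight E κ₀) ⊗ₖ (Kernel.prodMkLeft (Ω × E) κF)) 1
    exact eps_le_one_of_minorised hmin1
  -- the weight: bounded, measurable, with mean `e^{−ΔF}`
  have hf : Measurable fun p : Ω × E => Real.exp (-W p.2) :=
    Real.measurable_exp.comp (h.measurable_W.comp measurable_snd).neg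
  have hC : ∀ p : Ω × E, |Real.exp (-W p.2)| ≤ Real.exp (-Wlo) := fun p => by
    rw [abs_of_pos (Real.exp_pos _)]; exact Real.exp_le_exp.2 (neg_le_neg (hlo p.2))
  have hu : ∫ p, Real.exp (-W p.2) ∂(π₀ ⊗ₘ κF) = Real.exp (-ΔF) := by
    rw [restart_jarzynski_mean h hπ₀, hΔF]
  have hu0 : 0 < ∫ p, Real.exp (-W p.2) ∂(π₀ ⊗ₘ κF) := by rw [hu]; exact Real.exp_pos _
  -- `φ = −log`, `D = −1/q`
  have hφ : HasDerivAt (fun q : ℝ => -Real.log q) (-(∫ p, Real.exp (-W p.2) ∂(π₀ ⊗ₘ κF))⁻¹)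
      (∫ p, Real.exp (-W p.2) ∂(π₀ ⊗ₘ κF)) := (Real.hasDerivAt_log hu0.ne').neg
  have key := doeblinPower_batchMeans_deltaMethod_clt (invariant_restart hinv) hmin1 hε0 hε1 one_pos
    hf hC hσ hφ Real.measurable_log.neg (neg_ne_zero.2 (inv_ne_zero hu0.ne')) measurable_inv.neg
    (continuousAt_inv₀ hu0.ne').neg rfl μ₀ ha hb hY
  have hφu : -Real.log (∫ p, Real.exp (-W p.2) ∂(π₀ ⊗ₘ κF)) = ΔF := by
    rw [hu, Real.log_exp, neg_neg]
  rw [hφu] at key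
  exact key

omit [IsFiniteMeasure ν₀] [IsFiniteMeasure ν₁] in
/-- **ASYMPTOTICALLY EXACT COVERAGE OF THE REPORTED `ΔF` INTERVAL.**  Under the hypotheses of
`restart_jarzynski_deltaF_studentized_clt`, for every `z > 0`:
`P_{μ₀} {|√N_n (−log Ḡ − ΔF)| / (|−Ḡ⁻¹| √(σ̂²_n)) ≤ z} → (gaussianReal 0 1)[−z, z]`. -/
theorem restart_jarzynski_deltaF_coverage (h : CrooksPair ν₀ ν₁ κF κR s e W)
    (hπ₀ : π₀ = (ν₀ univ)⁻¹ • ν₀) (hinv : Kernel.Invariant κ₀ π₀)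
    (hmin : ∀ x {B : Set Ω}, MeasurableSet B → ε * π₀ B ≤ κ₀ x B) (hε0 : 0 < ε)
    {Wlo : ℝ} (hlo : ∀ ω, Wlo ≤ W ω)
    {ΔF : ℝ} (hΔF : Real.exp (-ΔF) = ((ν₀ univ)⁻¹ * ν₁ univ).toReal)
    (hσ : 0 < ((∫ p, (Real.exp (-W p.2) - ∫ p', Real.exp (-W p'.2) ∂(π₀ ⊗ₘ κF)) ^ 2 ∂(π₀ ⊗ₘ κF))
          + 2 * ∑' k, ∫ p, (Real.exp (-W p.2) - ∫ p', Real.exp (-W p'.2) ∂(π₀ ⊗ₘ κF))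
            * (kop ((Kernel.prodMkRight E κ₀) ⊗ₖ (Kernel.prodMkLeft (Ω × E) κF)))^[k + 1]
              (fun p => Real.exp (-W p.2) - ∫ p', Real.exp (-W p'.2) ∂(π₀ ⊗ₘ κF)) p ∂(π₀ ⊗ₘ κF)))
    (μ₀ : Measure (Ω × E)) [IsProbabilityMeasure μ₀] {a b : ℕ → ℕ} (ha : Tendsto a atTop atTop)
    (hb : Tendsto b atTop atTop) {z : ℝ} (hz : 0 < z)
    [IsProbabilityMeasure (Kernel.trajMeasure (X := fun _ : ℕ => Ω × E) μ₀
          (fun n : ℕ => ((Kernel.prodMkRight E κ₀) ⊗ₖ (Kernel.prodMkLeft (Ω × E) κF)).comap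
            (fun h : (i : ↥(Finset.Iic n)) → Ω × E => h ⟨n, Finset.mem_Iic.2 le_rfl⟩)
            (measurable_pi_apply _)))] :
    Tendsto (fun n : ℕ => (Kernel.trajMeasure (X := fun _ : ℕ => Ω × E) μ₀
          (fun n : ℕ => ((Kernel.prodMkRight E κ₀) ⊗ₖ (Kernel.prodMkLeft (Ω × E) κF)).comap
            (fun h : (i : ↥(Finset.Iic n)) → Ω × E => h ⟨n, Finset.mem_Iic.2 le_rfl⟩)
            (measurable_pi_apply _))).real
      {x | |Real.sqrt ((b n * a n : ℕ) : ℝ)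
          * (-Real.log ((∑ t ∈ Finset.range (b n * a n), Real.exp (-W (x t).2))
            / ((b n * a n : ℕ) : ℝ)) - ΔF)
         
          / (|(-((∑ t ∈ Finset.range (b n * a n), Real.exp (-W (x t).2)) / ((b n * a n : ℕ) : ℝ))⁻¹)|
            * Real.sqrt (((b n * a n : ℕ) : ℝ) * replicaSEsq (fun j (x : ℕ → Ω × E) =>
              (∑ i ∈ Finset.range (b n), Real.exp (-W (x (b n * j + i)).2)) / (b n)) (a n) x))| ≤ z})
      atTop (𝓝 ((gaussianReal 0 1).real (Set.Icc (-z) z))) := by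
  have hY : HasLaw (fun a : ℝ => a) (gaussianReal 0 1) (gaussianReal 0 1) :=
    ⟨aemeasurable_id', Measure.map_id'⟩
  have hclt := restart_jarzynski_deltaF_studentized_clt h hπ₀ hinv hmin hε0 hlo hΔF hσ μ₀ ha hb hY
  have hE : ((gaussianReal 0 1).map (fun a : ℝ => a)) (frontier (Set.Icc (-z) z)) = 0 := by
    rw [Measure.map_id', frontier_Icc (by linarith)]
    haveI := nullSingletonClass_gaussianReal (μ := 0) one_ne_zero
    exact (Set.toFinite _).measure_zero _
  have key := ProbabilityMeasure.tendsto_measure_of_null_frontier_of_tendsto' hclt.tendsto hE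
  have key' := (ENNReal.tendsto_toReal (measure_ne_top _ (Set.Icc (-z) z))).comp key
  simp only [ProbabilityMeasure.coe_mk, Function.comp_def, Measure.map_id'] at key'
  simp only [measureReal_def]
  refine (tendsto_congr fun n => ?_).1 key'
  rw [Measure.map_apply_of_aemeasurable (hclt.forall_aemeasurable n) measurableSet_Icc]
  congr 2
  ext x
  simp only [Set.mem_preimage, Set.mem_Icc, Set.mem_setOf_eq, abs_le]

end Restart

end Summit.Ventures.LatticeQCDFlow.Scoring

end
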